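import Mathlib
import Literature.NumberTheory.LFunctions.Zhang2022.Section16TwoFactorMinus
import HarnessLib

/-!
# Zhang (2022) §16 Lemma 16.2 (row G-d57-1): the `q = 2` VALUE clause `hval_two` of the Block-D
# assembly `Lemma162R.lemma162Rq_of_values` — both branches `χ(2) = ±1`, error `O(α)`

Topic `Literature/NumberTheory/LFunctions/Zhang2022` (Landau–Siegel audit tree; verdict-neutral).
Y. Zhang, *Discrete mean estimates and the Landau–Siegel zero*, arXiv:2211.02515v1 (2022)
[Zhang2022LandauSiegel] — **an unrefereed manuscript under adjudication; nothing here asserts or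
denies its Theorems 1–2 or anything about Landau–Siegel zeros.** ZHANG-L discharge lane, WP16
BLOCK D (Lemma 16.2; carve of record: zl-w09-p6 = "the prime 2"; interface `HvalTwo` of the planner's
`SketchHval.lean`, binder of zl-w09-p2's `lemma162Rq_of_values`). For `2 ∤ D` (so `χ(2) = ±1` for a
quadratic `χ`), the `2`-Euler factor of `E₂ⱼ` at `s = 1`, `N₂(1)·Σ_e ϖ₂ⱼ(2^e)(ν∗χ)(2^e)2^{−e}`, is
within `100·(α log 2/2)` of the `q = 2` factor of the main term: `3/8` if `χ(2) = 1`
(`twoFactor_value_star`, `Section16TwoFactorStar`), `(1−¼)/frakpFactor χ 2 = 9/16` if `χ(2) = −1`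
(`twoFactor_value_minus`, `Section16TwoFactorMinus`).

* `hval_two` — the text `HvalTwo c′` VERBATIM (with `C = 100`).

Theorem-only; no definitions, no new facts.

## References

* Y. Zhang, arXiv:2211.02515v1 (2022), §16 Lemma 16.2 p. 94; App. A p. 105.
  [cite: Zhang2022LandauSiegel, §16 Lemma 16.2 p.94; App. A p.105]
-/

noncomputable section

open Complex Real Finset

namespace Literature.NumberTheory.LFunctions.Zhang2022.Lemma162R

open Literature.NumberTheory.LFunctions.Zhang2022
open Literature.NumberTheory.LFunctions.Zhang2022.Skeleton
open Literature.NumberTheory.LFunctions.Zhang2022.Typed.Section16A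
open Literature.NumberTheory.LFunctions.Zhang2022.Typed.Section16B

open scoped Classical in
/-- **`hval_two`** — the `q = 2` value clause of Block D (text `HvalTwo c′` of the planner's interface,
binder of `lemma162Rq_of_values`): for `D` large under (A), `j ∈ {1,2}` and `2 ∤ D`,
`‖N₂(1)·Σ_e ϖ₂ⱼ(2^e)(ν∗χ)(2^e)2^{−e} − m₂‖ ≤ 100·(α·log 2/2)`, `m₂ = 3/8` (`χ(2) = 1`) resp.
`(1−¼)/frakpFactor χ 2` (`χ(2) = −1`). [cite: Zhang2022LandauSiegel, §16 Lemma 16.2 p.94; App. A p.105] -/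
theorem hval_two (c' : ℝ) : ∃ C : ℝ, ForAllLarge fun D _ χ => AssumptionA D χ →
    ∀ j ∈ ({1, 2} : Finset ℕ), ¬ 2 ∣ D →
      ‖(1 - (2 : ℂ) ^ (-(1 : ℂ))) ^ 2 * (1 - (2 : ℂ) ^ betaJ c' D j * (2 : ℂ) ^ (-(1 : ℂ))) *
              (1 - χ (2 : ZMod D) * (2 : ℂ) ^ (-(1 : ℂ))) *
                (1 - χ (2 : ZMod D) * ((2 : ℂ) ^ betaJ c' D j * (2 : ℂ) ^ (-(1 : ℂ)))) ^ 2 *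
            (∑' e : ℕ, varpi2 c' χ j (2 ^ e) * nuConvChi χ (2 ^ e) * ((2 : ℂ) ^ (-(1 : ℂ))) ^ e) -
          (if χ (2 : ZMod D) = 1 then (3 / 8 : ℂ) else (1 - ((2 : ℂ) ^ 2)⁻¹) / frakpFactor χ 2)‖ ≤
        C * (alpha D * Real.log 2 / 2) := by
  obtain ⟨D₁, hD₁⟩ := twoFactor_value_star c'
  obtain ⟨D₂, hD₂⟩ := twoFactor_value_minus c'
  refine ⟨100, ForAllLarge.of_le (max D₁ D₂) fun D _ χ hD hq hprim hA j hj h2 => ?_⟩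
  have hDD₁ : D₁ ≤ D := le_trans (le_max_left _ _) hD
  have hDD₂ : D₂ ≤ D := le_trans (le_max_right _ _) hD
  have hα0 : 0 ≤ alpha D := by
    rw [alpha, bigP, Real.log_exp]; exact div_nonneg Real.pi_pos.le (pow_nonneg (by rw [ell]; exact Real.log_natCast_nonneg D) 9)
  have hlog2 : (0.69 : ℝ) ≤ Real.log 2 := by have := Real.log_two_gt_d9; linarith
  -- `χ(2) ≠ 0` as `2` is a unit mod `D`
  have hunit : IsUnit ((2 : ℕ) : ZMod D) := by
    rw [ZMod.isUnit_iff_coprime]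
    exact (Nat.Prime.coprime_iff_not_dvd Nat.prime_two).mpr h2
  have hne0 : χ (2 : ZMod D) ≠ 0 := by
    have h := (hunit.map χ).ne_zero
    exact_mod_cast h
  set S : ℂ := ∑' e : ℕ, varpi2 c' χ j (2 ^ e) * nuConvChi χ (2 ^ e) * ((2 : ℂ) ^ (-(1 : ℂ))) ^ e
    with hS
  rcases hq (2 : ZMod D) with h0 | h1 | hm1
  · exact absurd h0 hne0
  · -- `χ(2) = 1`: the STAR branch, value `3/8`
    have key := hD₁ D χ hDD₁ hq hprim hA h1 j hj
    rw [if_pos h1, h1]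
    have hE : (1 - (2 : ℂ) ^ (-(1 : ℂ))) ^ 2 * (1 - (2 : ℂ) ^ betaJ c' D j * (2 : ℂ) ^ (-(1 : ℂ))) *
          (1 - (1 : ℂ) * (2 : ℂ) ^ (-(1 : ℂ))) *
            (1 - (1 : ℂ) * ((2 : ℂ) ^ betaJ c' D j * (2 : ℂ) ^ (-(1 : ℂ)))) ^ 2 * S =
        ((1 - (2 : ℂ) ^ (-(1 : ℂ))) ^ 3 * (1 - (2 : ℂ) ^ betaJ c' D j * (2 : ℂ) ^ (-(1 : ℂ))) ^ 3) * S := by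
      ring
    rw [hE]
    calc _ ≤ 10 * alpha D := key
      _ ≤ 100 * (alpha D * Real.log 2 / 2) := by nlinarith
  · -- `χ(2) = −1`: value `(1 − ¼)/frakpFactor χ 2 = 9/16`
    have key := hD₂ D χ hDD₂ hq hprim hA hm1 j hj
    have hne1 : χ (2 : ZMod D) ≠ 1 := by rw [hm1]; norm_num
    have hm1' : χ ((2 : ℕ) : ZMod D) = -1 := by exact_mod_cast hm1
    have hval : (1 - ((2 : ℂ) ^ 2)⁻¹) / frakpFactor χ 2 = 9 / 16 := by
      rw [frakpFactor, hm1']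
      norm_num
    rw [if_neg hne1, hval, hm1]
    have hE : (1 - (2 : ℂ) ^ (-(1 : ℂ))) ^ 2 * (1 - (2 : ℂ) ^ betaJ c' D j * (2 : ℂ) ^ (-(1 : ℂ))) *
          (1 - (-1 : ℂ) * (2 : ℂ) ^ (-(1 : ℂ))) *
            (1 - (-1 : ℂ) * ((2 : ℂ) ^ betaJ c' D j * (2 : ℂ) ^ (-(1 : ℂ)))) ^ 2 * S =
        ((1 - (2 : ℂ) ^ (-(1 : ℂ))) ^ 2 * (1 - (2 : ℂ) ^ betaJ c' D j * (2 : ℂ) ^ (-(1 : ℂ))) *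
          (1 + (2 : ℂ) ^ (-(1 : ℂ))) * (1 + (2 : ℂ) ^ betaJ c' D j * (2 : ℂ) ^ (-(1 : ℂ))) ^ 2) * S := by
      ring
    rw [hE]
    calc _ ≤ 32 * alpha D := key
      _ ≤ 100 * (alpha D * Real.log 2 / 2) := by nlinarith

end Literature.NumberTheory.LFunctions.Zhang2022.Lemma162R

end
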